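import Summits.KontsevichZagierPeriods.Zeta5Search.Barrier.ConeGammaCuspPeriodType

/-!
# ζ(5) search — BARRIER: FINITE CERTIFICATES FOR «σ ≤ 0 IN EVERY DIRECTION» from the type of the period

HONEST FRAMING (cell `pub-zeta5`): systematic search; no irrationality claim unless kernel-certified. MODEL objects
under Brown–Zudilin's (28)+(30) accounting ([BZ22] = arXiv:2210.03391; (28) observed, not proved); nothing here is a
statement about `ζ(5)`, any `γ` of record, the cone's supremum (C2 OPEN) or the value / sign of the cusp slope at a named
direction; NO certificate is asserted for any named direction (at record/41, flag/60, argmax-120, t*/480 the period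
pattern function is of no pure type — DATA — so the hypotheses below are not met there); S-E stays CONJECTURED; records
in print UNMOVED. Prover P2 g31, item «ONE SET FUNCTION» (INBOX 2026-08-27), file (3).

P2 g29 reduced «σ ≤ 0 in every direction» to a finite test PER CHAMBER (`cuspSlope_nonpos_of_generators`), and P2 g30's
desk found the chamber list practically infinite (5 000 random displacements, 5 000 flip-order types). With ONE set
function `F` (file (1)) and its type as the hypothesis (file (2)) the test becomes finite outright:
* ANY `F`: `sum_mul_rate_eq_sum_coord` (a chamber functional is determined by its 8 coordinate values),
  **`cuspSlope_nonpos_of_forall_greedy_nonpos`** / `cuspSlope_pos_of_forall_greedy_pos` (at ONE `δ`: `σ(δ)` lies between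
  the smallest and the largest chamber functional at `δ`), `cuspSlope_eq_zero_of_forall_greedy_eq_zero`;
* SUPERMODULAR `F` — **`cuspSlope_nonpos_of_hull_certificate`**: finitely many generic references `δ₀^{(j)}` and weights
  `t_j ≥ 0`, `Σ t_j > 0`, with `Σ_j t_j · G_j ≡ 0` (zero in the convex hull of the chamber gradients — by Carathéodory at
  most 8 of them) give `σ ≤ 0` in EVERY direction; **`cuspSlope_nonpos_of_hull_certificate_coord`** — the same with the
  hypothesis checked on the 8 coordinate displacements only (a finite rational certificate);
  **`cuspSlope_nonneg_iff_forall_greedy_nonneg_of_supermodular`** — the ascent set `{σ ≥ 0}` is the intersection of the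
  chamber half-spaces `{G_{δ₀} ≥ 0}`. (Gordan's alternative says the hull certificate EXISTS whenever a concave `σ` never
  ascends; that converse is not proved here.)
* SUBMODULAR `F` — **`forall_greedy_eq_zero_of_submodular_of_nonpos`**: `σ ≤ 0` in every direction iff EVERY chamber
  functional vanishes identically (then `σ ≡ 0`, file (2)).
DESK (DATA, `HOME/pub-zeta5-p2/g31/alg/periodlovasz.py` (L4)): zero lies in the convex hull of the chamber gradients of
80 / 80 / 60 / 40 random generic references at record / flag / argmax-120 / t*, support 8 each — at t* together with
the ascent directions `±w` this REFUTES supermodularity of `F` there; at the other three it certifies nothing absent the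
type. NOT here: any certificate at a named direction; `γ`, C2, S-E, `ζ(5)`.
-/

noncomputable section

open Set MeasureTheory Finset
open scoped Topology

namespace Summit.KontsevichZagierPeriods.Zeta5Search.Barrier.ConeGamma

/-! ### A chamber functional is determined by its 8 coordinate values -/

/-- A displacement is the combination of the 8 coordinate displacements. -/
theorem disp_eq_sum_single (δ : Fin 8 → ℝ) : δ = ∑ p, δ p • (Pi.single p (1 : ℝ) : Fin 8 → ℝ) := by
  ext q
  simp only [Finset.sum_apply, Pi.smul_apply, Pi.single_apply, smul_eq_mul, mul_ite, mul_one, mul_zero,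
    Finset.sum_ite_eq, Finset.mem_univ, if_true]

/-- The 28 forms on the coordinate displacements: `φ_k(δ) = Σ_p δ_p · φ_k(e_p)`. -/
theorem phiForm_eq_sum_coord (δ : Fin 8 → ℝ) (k : Fin 28) :
    phiForm δ k = ∑ p, δ p * phiForm (Pi.single p (1 : ℝ)) k := by
  conv_lhs => rw [disp_eq_sum_single δ, phiForm_sum]
  exact Finset.sum_congr rfl fun p _ => by rw [phiForm_smul]

/-- **A weighted rate functional is linear in the displacement**: `Σ_k c_k·φ_k(δ)/h_k(a) =
Σ_p δ_p · (Σ_k c_k·φ_k(e_p)/h_k(a))` — it is determined by its values on the 8 coordinate displacements `e_p`. -/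
theorem sum_mul_rate_eq_sum_coord (a : Dir) (c : Fin 28 → ℝ) (δ : Fin 8 → ℝ) :
    ∑ k, c k * (phiForm δ k / h28 a k) = ∑ p, δ p * ∑ k, c k * (phiForm (Pi.single p (1 : ℝ)) k / h28 a k) := by
  simp_rw [Finset.mul_sum]
  rw [Finset.sum_comm]
  refine Finset.sum_congr rfl fun k _ => ?_
  rw [phiForm_eq_sum_coord δ k, Finset.sum_div, Finset.mul_sum]
  exact Finset.sum_congr rfl fun p _ => by ring

/-! ### Any period pattern function: `σ(δ)` lies between the extreme chamber functionals at `δ` -/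

/-- **CHAMBER-WISE UPPER TEST AT ONE DISPLACEMENT** (any `F`): if every chamber functional is `≤ 0` at `δ`, then
`cuspSlope a T δ ≤ 0` (for `σ(δ)` is one of them, `exists_generic_greedy_eq_cuspSlope`). -/
theorem cuspSlope_nonpos_of_forall_greedy_nonpos {a : Dir} (hpos : ∀ k, 0 < h28 a k) {T : ℝ} (hT : 0 < T)
    (hper : ∀ k : Fin 28, ∃ z : ℤ, T * h28 a k = z)
    {M : ℕ → Finset (Fin 28)} {f : ℕ → Finset (Fin 28) → ℝ}
    (hf : ∀ m, m + 1 < (bkpts a T).card → ∀ Δ : Fin 8 → ℝ, (∀ k, |phiForm Δ k| < 1) →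
      (∀ k, |phiForm Δ k| < wallDist a T) →
        (torusN (bkpt a T m • sParam a + Δ) : ℝ) = f m ((M m).filter fun k => 0 ≤ phiForm Δ k))
    {F : Finset (Fin 28) → ℝ} (hF : ∀ A, F A = ∑ m ∈ Finset.range ((bkpts a T).card - 1), f m (A ∩ M m))
    (δ : Fin 8 → ℝ)
    (hle : ∀ δ₀ : Fin 8 → ℝ, (∀ k l : Fin 28, k ≠ l → phiForm δ₀ k / h28 a k ≠ phiForm δ₀ l / h28 a l) →
      ∑ k, (F (Finset.univ.filter fun l => phiForm δ₀ k / h28 a k ≤ phiForm δ₀ l / h28 a l) -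
          F (Finset.univ.filter fun l => phiForm δ₀ k / h28 a k < phiForm δ₀ l / h28 a l)) *
        (phiForm δ k / h28 a k) ≤ 0) :
    cuspSlope a T δ ≤ 0 := by
  obtain ⟨δ₀, hgen, -, hσ⟩ := exists_generic_greedy_eq_cuspSlope hpos hT hper hf hF δ
  rw [hσ]; exact hle δ₀ hgen

/-- **CHAMBER-WISE LOWER TEST AT ONE DISPLACEMENT** (any `F`): if every chamber functional is `> 0` at `δ`, then
`0 < cuspSlope a T δ` — `δ` is an ascent direction. -/
theorem cuspSlope_pos_of_forall_greedy_pos {a : Dir} (hpos : ∀ k, 0 < h28 a k) {T : ℝ} (hT : 0 < T)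
    (hper : ∀ k : Fin 28, ∃ z : ℤ, T * h28 a k = z)
    {M : ℕ → Finset (Fin 28)} {f : ℕ → Finset (Fin 28) → ℝ}
    (hf : ∀ m, m + 1 < (bkpts a T).card → ∀ Δ : Fin 8 → ℝ, (∀ k, |phiForm Δ k| < 1) →
      (∀ k, |phiForm Δ k| < wallDist a T) →
        (torusN (bkpt a T m • sParam a + Δ) : ℝ) = f m ((M m).filter fun k => 0 ≤ phiForm Δ k))
    {F : Finset (Fin 28) → ℝ} (hF : ∀ A, F A = ∑ m ∈ Finset.range ((bkpts a T).card - 1), f m (A ∩ M m))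
    (δ : Fin 8 → ℝ)
    (hlt : ∀ δ₀ : Fin 8 → ℝ, (∀ k l : Fin 28, k ≠ l → phiForm δ₀ k / h28 a k ≠ phiForm δ₀ l / h28 a l) →
      0 < ∑ k, (F (Finset.univ.filter fun l => phiForm δ₀ k / h28 a k ≤ phiForm δ₀ l / h28 a l) -
          F (Finset.univ.filter fun l => phiForm δ₀ k / h28 a k < phiForm δ₀ l / h28 a l)) *
        (phiForm δ k / h28 a k)) :
    0 < cuspSlope a T δ := by
  obtain ⟨δ₀, hgen, -, hσ⟩ := exists_generic_greedy_eq_cuspSlope hpos hT hper hf hF δ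
  rw [hσ]; exact hlt δ₀ hgen

/-- **If every chamber functional vanishes identically, `σ ≡ 0`** (any `F`). -/
theorem cuspSlope_eq_zero_of_forall_greedy_eq_zero {a : Dir} (hpos : ∀ k, 0 < h28 a k) {T : ℝ} (hT : 0 < T)
    (hper : ∀ k : Fin 28, ∃ z : ℤ, T * h28 a k = z)
    {M : ℕ → Finset (Fin 28)} {f : ℕ → Finset (Fin 28) → ℝ}
    (hf : ∀ m, m + 1 < (bkpts a T).card → ∀ Δ : Fin 8 → ℝ, (∀ k, |phiForm Δ k| < 1) →
      (∀ k, |phiForm Δ k| < wallDist a T) →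
        (torusN (bkpt a T m • sParam a + Δ) : ℝ) = f m ((M m).filter fun k => 0 ≤ phiForm Δ k))
    {F : Finset (Fin 28) → ℝ} (hF : ∀ A, F A = ∑ m ∈ Finset.range ((bkpts a T).card - 1), f m (A ∩ M m))
    (hzero : ∀ δ₀ : Fin 8 → ℝ, (∀ k l : Fin 28, k ≠ l → phiForm δ₀ k / h28 a k ≠ phiForm δ₀ l / h28 a l) →
      ∀ δ : Fin 8 → ℝ, ∑ k, (F (Finset.univ.filter fun l => phiForm δ₀ k / h28 a k ≤ phiForm δ₀ l / h28 a l) -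
          F (Finset.univ.filter fun l => phiForm δ₀ k / h28 a k < phiForm δ₀ l / h28 a l)) *
        (phiForm δ k / h28 a k) = 0)
    (δ : Fin 8 → ℝ) : cuspSlope a T δ = 0 := by
  obtain ⟨δ₀, hgen, -, hσ⟩ := exists_generic_greedy_eq_cuspSlope hpos hT hper hf hF δ
  rw [hσ]; exact hzero δ₀ hgen δ

/-! ### Supermodular period: the convex-hull certificate -/

/-- **THE HULL CERTIFICATE (supermodular period).** With the data of `cuspSlope_eq_lovasz_period` and `F` supermodular:
if finitely many generic references `δ₀ j` (`j ∈ s`) and weights `t_j ≥ 0` with `Σ_{j∈s} t_j > 0` satisfy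
`Σ_{j∈s} t_j · G_j(δ) = 0` for every `δ` (`G_j` the chamber functional of `δ₀ j`) — i.e. zero lies in the convex hull of
the chamber gradients — then `cuspSlope a T δ ≤ 0` for EVERY displacement `δ`
(`(Σ t_j)·σ(δ) ≤ Σ t_j G_j(δ) = 0`). -/
theorem cuspSlope_nonpos_of_hull_certificate {a : Dir} (hpos : ∀ k, 0 < h28 a k) {T : ℝ} (hT : 0 < T)
    (hper : ∀ k : Fin 28, ∃ z : ℤ, T * h28 a k = z)
    {M : ℕ → Finset (Fin 28)} {f : ℕ → Finset (Fin 28) → ℝ}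
    (hf : ∀ m, m + 1 < (bkpts a T).card → ∀ Δ : Fin 8 → ℝ, (∀ k, |phiForm Δ k| < 1) →
      (∀ k, |phiForm Δ k| < wallDist a T) →
        (torusN (bkpt a T m • sParam a + Δ) : ℝ) = f m ((M m).filter fun k => 0 ≤ phiForm Δ k))
    {F : Finset (Fin 28) → ℝ} (hF : ∀ A, F A = ∑ m ∈ Finset.range ((bkpts a T).card - 1), f m (A ∩ M m))
    (hsuper : ∀ A B : Finset (Fin 28), F A + F B ≤ F (A ∪ B) + F (A ∩ B))
    {ι : Type*} (s : Finset ι) (δ₀ : ι → Fin 8 → ℝ)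
    (hgen : ∀ j ∈ s, ∀ k l : Fin 28, k ≠ l → phiForm (δ₀ j) k / h28 a k ≠ phiForm (δ₀ j) l / h28 a l)
    (t : ι → ℝ) (ht : ∀ j ∈ s, 0 ≤ t j) (htpos : 0 < ∑ j ∈ s, t j)
    (hzero : ∀ δ : Fin 8 → ℝ, ∑ j ∈ s, t j *
      ∑ k, (F (Finset.univ.filter fun l => phiForm (δ₀ j) k / h28 a k ≤ phiForm (δ₀ j) l / h28 a l) -
          F (Finset.univ.filter fun l => phiForm (δ₀ j) k / h28 a k < phiForm (δ₀ j) l / h28 a l)) *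
        (phiForm δ k / h28 a k) = 0)
    (δ : Fin 8 → ℝ) : cuspSlope a T δ ≤ 0 := by
  have hsum : (∑ j ∈ s, t j) * cuspSlope a T δ ≤ ∑ j ∈ s, t j *
      ∑ k, (F (Finset.univ.filter fun l => phiForm (δ₀ j) k / h28 a k ≤ phiForm (δ₀ j) l / h28 a l) -
          F (Finset.univ.filter fun l => phiForm (δ₀ j) k / h28 a k < phiForm (δ₀ j) l / h28 a l)) *
        (phiForm δ k / h28 a k) := by
    rw [Finset.sum_mul]
    exact Finset.sum_le_sum fun j hj => mul_le_mul_of_nonneg_left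
      (cuspSlope_le_greedy_period_of_supermodular hpos hT hper hf hF hsuper (hgen j hj) δ) (ht j hj)
  rw [hzero δ] at hsum
  have h' : (∑ j ∈ s, t j) * cuspSlope a T δ ≤ (∑ j ∈ s, t j) * 0 := by rwa [mul_zero]
  exact le_of_mul_le_mul_left h' htpos

/-- **THE HULL CERTIFICATE ON THE 8 COORDINATES** (supermodular period): the hypothesis of
`cuspSlope_nonpos_of_hull_certificate` need only be checked on the coordinate displacements `e_p`, `p < 8` — a finite
rational certificate (the 28 rates of each `e_p` and the integer weights of at most 8 references). -/
theorem cuspSlope_nonpos_of_hull_certificate_coord {a : Dir} (hpos : ∀ k, 0 < h28 a k) {T : ℝ} (hT : 0 < T)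
    (hper : ∀ k : Fin 28, ∃ z : ℤ, T * h28 a k = z)
    {M : ℕ → Finset (Fin 28)} {f : ℕ → Finset (Fin 28) → ℝ}
    (hf : ∀ m, m + 1 < (bkpts a T).card → ∀ Δ : Fin 8 → ℝ, (∀ k, |phiForm Δ k| < 1) →
      (∀ k, |phiForm Δ k| < wallDist a T) →
        (torusN (bkpt a T m • sParam a + Δ) : ℝ) = f m ((M m).filter fun k => 0 ≤ phiForm Δ k))
    {F : Finset (Fin 28) → ℝ} (hF : ∀ A, F A = ∑ m ∈ Finset.range ((bkpts a T).card - 1), f m (A ∩ M m))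
    (hsuper : ∀ A B : Finset (Fin 28), F A + F B ≤ F (A ∪ B) + F (A ∩ B))
    {ι : Type*} (s : Finset ι) (δ₀ : ι → Fin 8 → ℝ)
    (hgen : ∀ j ∈ s, ∀ k l : Fin 28, k ≠ l → phiForm (δ₀ j) k / h28 a k ≠ phiForm (δ₀ j) l / h28 a l)
    (t : ι → ℝ) (ht : ∀ j ∈ s, 0 ≤ t j) (htpos : 0 < ∑ j ∈ s, t j)
    (hzero : ∀ p : Fin 8, ∑ j ∈ s, t j *
      ∑ k, (F (Finset.univ.filter fun l => phiForm (δ₀ j) k / h28 a k ≤ phiForm (δ₀ j) l / h28 a l) -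
          F (Finset.univ.filter fun l => phiForm (δ₀ j) k / h28 a k < phiForm (δ₀ j) l / h28 a l)) *
        (phiForm (Pi.single p (1 : ℝ)) k / h28 a k) = 0)
    (δ : Fin 8 → ℝ) : cuspSlope a T δ ≤ 0 := by
  refine cuspSlope_nonpos_of_hull_certificate hpos hT hper hf hF hsuper s δ₀ hgen t ht htpos (fun δ' => ?_) δ
  -- linearity in `δ'`: expand every chamber functional on the coordinate displacements
  obtain ⟨A, hA⟩ : ∃ A : ι → Fin 8 → ℝ, ∀ j p, A j p =
      ∑ k, (F (Finset.univ.filter fun l => phiForm (δ₀ j) k / h28 a k ≤ phiForm (δ₀ j) l / h28 a l) -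
          F (Finset.univ.filter fun l => phiForm (δ₀ j) k / h28 a k < phiForm (δ₀ j) l / h28 a l)) *
        (phiForm (Pi.single p (1 : ℝ)) k / h28 a k) := ⟨_, fun _ _ => rfl⟩
  have hz : ∀ p, ∑ j ∈ s, t j * A j p = 0 := fun p => by simp only [hA]; exact hzero p
  refine (Finset.sum_congr rfl fun j _ => show _ = t j * ∑ p, δ' p * A j p by
    rw [sum_mul_rate_eq_sum_coord]; simp only [hA]).trans ?_
  simp_rw [Finset.mul_sum]
  rw [Finset.sum_comm]
  refine Finset.sum_eq_zero fun p _ => ?_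
  have e : ∑ j ∈ s, t j * (δ' p * A j p) = δ' p * ∑ j ∈ s, t j * A j p := by
    rw [Finset.mul_sum]
    exact Finset.sum_congr rfl fun j _ => by ring
  rw [e, hz p, mul_zero]

/-- **THE ASCENT CONE IS THE INTERSECTION OF THE CHAMBER HALF-SPACES** (supermodular period): `0 ≤ σ(δ)` iff
`0 ≤ G_{δ₀}(δ)` for EVERY generic reference `δ₀`. -/
theorem cuspSlope_nonneg_iff_forall_greedy_nonneg_of_supermodular {a : Dir} (hpos : ∀ k, 0 < h28 a k) {T : ℝ}
    (hT : 0 < T) (hper : ∀ k : Fin 28, ∃ z : ℤ, T * h28 a k = z)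
    {M : ℕ → Finset (Fin 28)} {f : ℕ → Finset (Fin 28) → ℝ}
    (hf : ∀ m, m + 1 < (bkpts a T).card → ∀ Δ : Fin 8 → ℝ, (∀ k, |phiForm Δ k| < 1) →
      (∀ k, |phiForm Δ k| < wallDist a T) →
        (torusN (bkpt a T m • sParam a + Δ) : ℝ) = f m ((M m).filter fun k => 0 ≤ phiForm Δ k))
    {F : Finset (Fin 28) → ℝ} (hF : ∀ A, F A = ∑ m ∈ Finset.range ((bkpts a T).card - 1), f m (A ∩ M m))
    (hsuper : ∀ A B : Finset (Fin 28), F A + F B ≤ F (A ∪ B) + F (A ∩ B)) (δ : Fin 8 → ℝ) :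
    0 ≤ cuspSlope a T δ ↔
      ∀ δ₀ : Fin 8 → ℝ, (∀ k l : Fin 28, k ≠ l → phiForm δ₀ k / h28 a k ≠ phiForm δ₀ l / h28 a l) →
        0 ≤ ∑ k, (F (Finset.univ.filter fun l => phiForm δ₀ k / h28 a k ≤ phiForm δ₀ l / h28 a l) -
            F (Finset.univ.filter fun l => phiForm δ₀ k / h28 a k < phiForm δ₀ l / h28 a l)) *
          (phiForm δ k / h28 a k) := by
  constructor
  · intro h δ₀ hgen
    exact h.trans (cuspSlope_le_greedy_period_of_supermodular hpos hT hper hf hF hsuper hgen δ)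
  · intro h
    obtain ⟨δ₀, hgen, -, hσ⟩ := exists_generic_greedy_eq_cuspSlope hpos hT hper hf hF δ
    rw [hσ]; exact h δ₀ hgen

/-! ### Submodular period: `σ ≤ 0` everywhere iff every chamber functional vanishes -/

/-- **SUBMODULAR PERIOD: NO ASCENT ANYWHERE IFF EVERY CHAMBER FUNCTIONAL IS IDENTICALLY ZERO.** If `F` is submodular and
`σ ≤ 0` in every direction, then for every generic `δ₀` and every `δ` the chamber functional `G_{δ₀}(δ)` vanishes
(`G ≤ σ ≤ 0` at `δ` and at `−δ`, and `G` is odd); the converse is `cuspSlope_eq_zero_of_forall_greedy_eq_zero`. -/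
theorem forall_greedy_eq_zero_of_submodular_of_nonpos {a : Dir} (hpos : ∀ k, 0 < h28 a k) {T : ℝ} (hT : 0 < T)
    (hper : ∀ k : Fin 28, ∃ z : ℤ, T * h28 a k = z)
    {M : ℕ → Finset (Fin 28)} {f : ℕ → Finset (Fin 28) → ℝ}
    (hf : ∀ m, m + 1 < (bkpts a T).card → ∀ Δ : Fin 8 → ℝ, (∀ k, |phiForm Δ k| < 1) →
      (∀ k, |phiForm Δ k| < wallDist a T) →
        (torusN (bkpt a T m • sParam a + Δ) : ℝ) = f m ((M m).filter fun k => 0 ≤ phiForm Δ k))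
    {F : Finset (Fin 28) → ℝ} (hF : ∀ A, F A = ∑ m ∈ Finset.range ((bkpts a T).card - 1), f m (A ∩ M m))
    (hsub : ∀ A B : Finset (Fin 28), F (A ∪ B) + F (A ∩ B) ≤ F A + F B)
    (hnonpos : ∀ δ, cuspSlope a T δ ≤ 0)
    {δ₀ : Fin 8 → ℝ} (hgen : ∀ k l : Fin 28, k ≠ l → phiForm δ₀ k / h28 a k ≠ phiForm δ₀ l / h28 a l)
    (δ : Fin 8 → ℝ) :
    ∑ k, (F (Finset.univ.filter fun l => phiForm δ₀ k / h28 a k ≤ phiForm δ₀ l / h28 a l) -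
        F (Finset.univ.filter fun l => phiForm δ₀ k / h28 a k < phiForm δ₀ l / h28 a l)) *
      (phiForm δ k / h28 a k) = 0 := by
  have h1 := (greedy_period_le_cuspSlope_of_submodular hpos hT hper hf hF hsub hgen δ).trans (hnonpos δ)
  have h2 := (greedy_period_le_cuspSlope_of_submodular hpos hT hper hf hF hsub hgen (-δ)).trans (hnonpos (-δ))
  have hodd : ∑ k, (F (Finset.univ.filter fun l => phiForm δ₀ k / h28 a k ≤ phiForm δ₀ l / h28 a l) -
        F (Finset.univ.filter fun l => phiForm δ₀ k / h28 a k < phiForm δ₀ l / h28 a l)) *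
      (phiForm (-δ) k / h28 a k) =
      -∑ k, (F (Finset.univ.filter fun l => phiForm δ₀ k / h28 a k ≤ phiForm δ₀ l / h28 a l) -
        F (Finset.univ.filter fun l => phiForm δ₀ k / h28 a k < phiForm δ₀ l / h28 a l)) *
      (phiForm δ k / h28 a k) := by
    rw [← Finset.sum_neg_distrib]
    exact Finset.sum_congr rfl fun k _ => by rw [phiForm_neg]; ring
  rw [hodd] at h2
  linarith

end Summit.KontsevichZagierPeriods.Zeta5Search.Barrier.ConeGamma

end
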